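import Summits.QuantumAdvantage.QuantumAdvantage.Theses.SosSandwich
import Summits.QuantumAdvantage.QuantumAdvantage.Theorems.SosSandwichHomogeneousPBAAAddrStep

/-!
# Route `SosSandwich`: the homogeneous rung `HomogeneousPBAA` (stmt-QuantumAdvantage-15241) is FALSE

`HomogeneousPBAA` (support item of route SosSandwich, and stub `stub_homogeneousRung` of the registered line
`Cruxes/PseudoBoundedAA/Lines/birth.lean` of the crux `PseudoBoundedAA`, stmt-QuantumAdvantage-15237) asserts an
ABSOLUTE constant `C > 0` such that every polynomial `p` that is pseudo-bounded of order `T` (`p` and `1 - p` are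
sums of squares of polynomials of total degree `≤ T` on the cube) and TOP-HOMOGENEOUS (Laplacian eigen-equation
`Σᵢ (p − p∘flipᵢ) = 4T (p − E p)`, i.e. `p − E p` on Fourier level exactly `2T`) with `Var[p] > 0` has a variable
with `Infᵢ[p] ≥ C · Var[p]²` (Escudero Gutiérrez, arXiv:2304.06713, Thm. 1.6 / Cor. 1.7, transported from the
Fourier-completely-bounded ball to the SOS sandwich class `K_T`).

We REFUTE it with an explicit family. Let `A(y₁,y₂,y₃,y₄) = (y₁y₃ + y₁y₄ + y₂y₃ − y₂y₄)/2`, the `±1`-valued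
"address" function of four `±1` bits (if `y₃ = y₄` it returns `y₁y₃`, else `y₂y₃`): it is a HOMOGENEOUS
quadratic, balanced, and every variable has influence `1/2`. Its `k`-fold self-composition
`G_k = A(G_{k-1}, G_{k-1}, G_{k-1}, G_{k-1})` (four disjoint blocks; `G₀ = 1 − 2x₀`) is a `±1`-valued polynomial
of total degree `≤ 2^k`, balanced, homogeneous of degree `2^k` (`Σᵢ (G − G∘flipᵢ) = 2·2^k·G`), and EVERY variable
has `E (G − G∘flipᵢ)² = 4·2^{-k}` (`AddrWitness.exists_addr`). For two disjoint copies `G(x), G(x')` put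

  `p = (1 + G(x) G(x'))/2 = ((G(x) + G(x'))/2)²`,  `1 − p = ((G(x) − G(x'))/2)²`

(using `G² = 1` on the cube): `p` is pseudo-bounded of order `2^k` with ONE square on each side, `E p = 1/2`,
`p − 1/2 = G G'/2` satisfies the Laplacian eigen-equation of order `T = 2^k` (level `2·2^k = 2T`),
`Var[p] = 1/4`, and every influence equals `2^{-k}` (`AddrWitness.exists_counterexample`, phrased through the
tree's XOR-composition `p = h ⊕ h`, `h = (1 + G)/2`, of `SosSandwichHomogeneousPBAAXorComposition`). Hence
`C/16 ≤ 2^{-k}` for every `k`, impossible: `not_HomogeneousPBAA`.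

Consequences (recorded, not used here): the registered line `birth` of crux `PseudoBoundedAA` is dead at
`stub_homogeneousRung`; the crux itself is NOT refuted by this family (its influences are `1/T`, allowed by
`C (ε/T)^c`), i.e. the `T`-loss in PB-AA is necessary already on the top-homogeneous Boolean corner of `K_T`
(`maxInf = 16·Var²/T` here). The family lies in the `K_T ∖ Q_T` territory named by the route's own
"why it might fail" (on `Q_T`, Escudero Gutiérrez's Cor. 1.7 gives `maxInf ≥ Var²`).

All proofs are elementary cube bookkeeping (block sums, flips in one block), no named facts.
[cite: EscuderoGutierrez2023, Thm. 1.6, Cor. 1.7] [cite: ODonnell2014, §2.2–§2.3] [cite: KaniewskiLeeDewolf2015, Def. 7]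
-/

set_option linter.dupNamespace false -- D-0017: single-problem summit ⇒ `QuantumAdvantage.QuantumAdvantage` by design

noncomputable section

namespace Summit.QuantumAdvantage.QuantumAdvantage.Theorems.SosSandwich

open Finset MvPolynomial Literature.Computability.QuantumComplexity

namespace AddrWitness

/-! ### The iterated address function `G_k` -/

/-- **The iterated address function.** For every `k` there is a polynomial `G` (on `4^k` Boolean variables) of
total degree `≤ 2^k`, `±1`-valued on the cube, balanced, satisfying the Laplacian eigen-equation
`Σᵢ (G − G∘flipᵢ) = 2·2^k·G` (homogeneous of degree `2^k`), all of whose flip-sensitivities are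
`E (G − G∘flipᵢ)² = 4/2^k` (every influence of the Boolean function is `2^{-k}`). [folklore] -/
theorem exists_addr (k : ℕ) : ∃ (n : ℕ) (G : MvPolynomial (Fin n) ℝ),
    G.totalDegree ≤ 2 ^ k ∧
    (∀ x, evalBool G x = 1 ∨ evalBool G x = -1) ∧
    boolAvg (evalBool G) = 0 ∧
    (∀ x, ∑ i, (evalBool G x - evalBool G (flipBit i x)) = 2 * (2 : ℝ) ^ k * evalBool G x) ∧
    (∀ i, boolAvg (fun x => (evalBool G x - evalBool G (flipBit i x)) ^ 2) = 4 / (2 : ℝ) ^ k) := by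
  induction k with
  | zero => exact ⟨1, 1 - C 2 * X 0, base_props⟩
  | succ k ih =>
    obtain ⟨n, G, h1, h2, h3, h4, h5⟩ := ih
    refine ⟨(n + n) + (n + n), C (1 / 2) *
      (rename (Fin.castAdd (n + n)) (rename (Fin.castAdd n) G) *
          rename (Fin.natAdd (n + n)) (rename (Fin.castAdd n) G + rename (Fin.natAdd n) G) +
        rename (Fin.castAdd (n + n)) (rename (Fin.natAdd n) G) *
          rename (Fin.natAdd (n + n)) (rename (Fin.castAdd n) G - rename (Fin.natAdd n) G)),
      ?_, ?_, ?_, ?_, ?_⟩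
    · refine (totalDegree_stepPoly h1).trans ?_
      rw [pow_succ]; omega
    · exact step_pm_one (evalBool_stepPoly G) h2
    · exact step_mean (evalBool_stepPoly G) h3
    · intro w
      rw [step_laplacian (evalBool_stepPoly G) h4 w]
      ring
    · intro i
      rw [step_influence (evalBool_stepPoly G) h2 h3 h5 i]
      ring

/-! ### The counterexample `p = (1 + G(x) G(x'))/2 = h ⊕ h`, `h = (1 + G)/2` -/

/-- **The counterexample at level `k+1`.** A polynomial `P` (on `2·4^{k+1}` variables) which is pseudo-bounded of
order `T = 2^{k+1}` (indeed `P = ((G+G')/2)²`, `1 − P = ((G−G')/2)²` on the cube), satisfies the Laplacian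
eigen-equation of order `T` with mean `1/2`, has variance `1/4`, and ALL of whose influences equal `1/2^{k+1}`.
[folklore] -/
theorem exists_counterexample (k : ℕ) : ∃ (N : ℕ) (P : MvPolynomial (Fin N) ℝ),
    PseudoBounded (2 ^ (k + 1)) P ∧
    (∀ z, ∑ i, (evalBool P z - evalBool P (flipBit i z)) =
      4 * ((2 ^ (k + 1) : ℕ) : ℝ) * (evalBool P z - boolAvg (evalBool P))) ∧
    boolVariance P = 1 / 4 ∧
    (∀ i, influence i P = 1 / (2 : ℝ) ^ (k + 1)) := by
  obtain ⟨n, G, h1, h2, h3, h4, h5⟩ := exists_addr (k + 1)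
  -- `h = (1 + G)/2`, Boolean, mean `1/2`
  obtain ⟨H, hH⟩ : ∃ H : MvPolynomial (Fin n) ℝ, H = C (1 / 2) * (1 + G) := ⟨_, rfl⟩
  have hHev : ∀ x, evalBool H x = 1 / 2 * (1 + evalBool G x) := fun x => by
    rw [hH, evalBool_C_mul', evalBool_add', evalBool_one']
  have hsq : ∀ x, evalBool G x ^ 2 = 1 := sq_eq_one' h2
  have hm : boolAvg (evalBool H) = 1 / 2 := by
    rw [show evalBool H = fun x => 1 / 2 + 1 / 2 * evalBool G x from funext fun x => by rw [hHev x]; ring,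
      avg_add, boolAvg_const, avg_const_mul, h3]
    ring
  have hvarH : boolVariance H = 1 / 4 := by
    unfold boolVariance
    rw [hm, show (fun x => (evalBool H x - 1 / 2) ^ 2) = fun _ => (1 / 4 : ℝ) from funext fun x => by
      rw [hHev x]; linear_combination (1 / 4 : ℝ) * hsq x]
    exact boolAvg_const _
  have hinfH : ∀ i, influence i H = 1 / (2 : ℝ) ^ (k + 1) := fun i => by
    unfold influence
    rw [show (fun x => (evalBool H x - evalBool H (flipBit i x)) ^ 2) =
        fun x => 1 / 4 * (evalBool G x - evalBool G (flipBit i x)) ^ 2 from funext fun x => by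
      rw [hHev, hHev]; ring, avg_const_mul, h5 i]
    ring
  have hlapH : ∀ x, ∑ i, (evalBool H x - evalBool H (flipBit i x)) =
      4 * ((2 ^ k : ℕ) : ℝ) * (evalBool H x - boolAvg (evalBool H)) := fun x => by
    rw [hm]
    simp_rw [hHev]
    rw [show ∑ i, (1 / 2 * (1 + evalBool G x) - 1 / 2 * (1 + evalBool G (flipBit i x))) =
        1 / 2 * ∑ i, (evalBool G x - evalBool G (flipBit i x)) by
      rw [Finset.mul_sum]; exact Finset.sum_congr rfl fun i _ => by ring, h4 x]
    push_cast
    ring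
  -- the XOR-composition `P = h ⊕ h` on `Fin (n + n)`
  obtain ⟨-, hlapP⟩ := laplacian_xor H H hlapH hlapH hm hm
  have hT : 2 ^ k + 2 ^ k = 2 ^ (k + 1) := by ring
  rw [hT] at hlapP
  refine ⟨n + n, rename (Fin.castAdd n) H * rename (Fin.natAdd n) H +
      (1 - rename (Fin.castAdd n) H) * (1 - rename (Fin.natAdd n) H), ?_, hlapP, ?_, ?_⟩
  · -- pseudo-bounded of order `2^{k+1}` with ONE square on each side
    refine ⟨1, fun _ => C (1 / 2) * (rename (Fin.castAdd n) G + rename (Fin.natAdd n) G),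
      fun _ => C (1 / 2) * (rename (Fin.castAdd n) G - rename (Fin.natAdd n) G), fun _ => ⟨?_, ?_⟩, fun w => ?_⟩
    · refine (totalDegree_mul _ _).trans ?_
      rw [totalDegree_C, zero_add]
      exact (totalDegree_add _ _).trans (max_le ((totalDegree_rename_le _ _).trans h1)
        ((totalDegree_rename_le _ _).trans h1))
    · refine (totalDegree_mul _ _).trans ?_
      rw [totalDegree_C, zero_add]
      exact (totalDegree_sub _ _).trans (max_le ((totalDegree_rename_le _ _).trans h1)
        ((totalDegree_rename_le _ _).trans h1))
    · show evalBool (rename (Fin.castAdd n) H * rename (Fin.natAdd n) H +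
          (1 - rename (Fin.castAdd n) H) * (1 - rename (Fin.natAdd n) H)) w =
          ∑ j : Fin 1, evalBool (C (1 / 2) * (rename (Fin.castAdd n) G + rename (Fin.natAdd n) G)) w ^ 2 ∧
        1 - evalBool (rename (Fin.castAdd n) H * rename (Fin.natAdd n) H +
          (1 - rename (Fin.castAdd n) H) * (1 - rename (Fin.natAdd n) H)) w =
          ∑ j : Fin 1, evalBool (C (1 / 2) * (rename (Fin.castAdd n) G - rename (Fin.natAdd n) G)) w ^ 2
      rw [Fin.sum_univ_one, Fin.sum_univ_one, evalBool_xor, hHev, hHev, evalBool_C_mul', evalBool_add',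
        evalBool_C_mul', evalBool_sub', evalBool_rename_castAdd, evalBool_rename_natAdd]
      constructor
      · linear_combination (-1 / 4 : ℝ) * hsq (w ∘ Fin.castAdd n) + (-1 / 4 : ℝ) * hsq (w ∘ Fin.natAdd n)
      · linear_combination (-1 / 4 : ℝ) * hsq (w ∘ Fin.castAdd n) + (-1 / 4 : ℝ) * hsq (w ∘ Fin.natAdd n)
  · rw [boolVariance_xor H H hm hm, hvarH]; norm_num
  · intro i
    induction i using Fin.addCases with
    | left i => rw [influence_xor_castAdd H H hm i, hinfH, hvarH]; ring
    | right j => rw [influence_xor_natAdd H H hm j, hvarH, hinfH]; ring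

end AddrWitness

/-- **`HomogeneousPBAA` is false.** There is NO absolute constant `C > 0` with `maxᵢ Infᵢ[p] ≥ C·Var[p]²` for all
top-homogeneous pseudo-bounded `p`: the polynomials `p_k = (1 + G_k(x) G_k(x'))/2` built from the `k`-fold
iterated address function (`AddrWitness.exists_counterexample`) are pseudo-bounded of order `T = 2^k`, satisfy the
Laplacian eigen-equation of order `T`, have `Var = 1/4` and every influence equal to `2^{-k}`, so `C ≤ 16·2^{-k}`
for every `k`. (Refutes route item stmt-QuantumAdvantage-15241 = stub `stub_homogeneousRung` of line `birth` of
crux `PseudoBoundedAA`; the crux itself is not refuted: here `maxInf = 16 Var²/T`.)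
[cite: EscuderoGutierrez2023, Thm. 1.6, Cor. 1.7] -/
theorem not_HomogeneousPBAA :
    ¬ Summit.QuantumAdvantage.QuantumAdvantage.Theses.SosSandwich.HomogeneousPBAA := by
  rintro ⟨K, hK, h⟩
  obtain ⟨k, hk⟩ := pow_unbounded_of_one_lt (16 / K) (by norm_num : (1 : ℝ) < 2)
  obtain ⟨N, P, hPB, hLap, hVar, hInf⟩ := AddrWitness.exists_counterexample k
  have hVar' : 0 < boolVariance P := by rw [hVar]; norm_num
  obtain ⟨i, hi⟩ := h N (2 ^ (k + 1)) P Nat.one_le_two_pow hPB hLap hVar'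
  change K * boolVariance P ^ 2 ≤ influence i P at hi
  rw [hVar, hInf] at hi
  have h16 : 16 < K * 2 ^ k := by
    have := (div_lt_iff₀ hK).mp hk
    linarith [this]
  have hle : K * 2 ^ (k + 1) ≤ 16 := by
    have h2pos : (0 : ℝ) < 2 ^ (k + 1) := by positivity
    have := (le_div_iff₀ h2pos).mp hi
    linarith [this]
  have hmono : K * 2 ^ k ≤ K * 2 ^ (k + 1) :=
    mul_le_mul_of_nonneg_left (pow_le_pow_right₀ (by norm_num) (Nat.le_succ k)) hK.le
  linarith

end Summit.QuantumAdvantage.QuantumAdvantage.Theorems.SosSandwich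

end
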